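/-
Copyright: the b2b-balaban T⁴-continuum CRUX team, row NE7b leaf lineage `t4-ne7b-formalise-leaf-06` (gen 157). Project licence.
-/
import Summits.QuantumFields.BalabanUV.T4Continuum.Spine.NE7b.QuadraticFibreMinimiser
import Mathlib.Analysis.Normed.Operator.Bilinear

/-!
# THE HARD STEP IS MONOTONE IN THE FORM: a two-sided domination `γ₀·P ≤ Q ≤ γ₁·P` of the Hessian by a REFERENCE form passes to
# the transported forms with the SAME constants — `γ₀·P⁺ ≤ Q⁺` along ANY section, `Q⁺ ≤ γ₁·P⁺` along the critical one, where
# `P⁺ = P[H·, H·]` is the reference form's OWN hard step (its critical section `H`) — so along a tower the interacting forms stay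
# sandwiched between the SAME multiples of the reference FLOW, and the next step's floor and size letters are the reference flow's,
# times `γ₀` ∕ `γ₁`, with no transport loss and nothing compounding (row NE7b, node U5c; [folklore] — W. N. Anderson's monotonicity of
# the shorted operator ∕ Schur complement, SIAM J. Appl. Math. 20 (1971); here two lines over leaf-03's QFM BY NAME)

Cell `pub-balaban`, sub-cell `t4`, spine estimate NE7b (`T4WeightBudget.RelWeightBound`; the cell's OWN estimate — NOT PRINTED in
[Bałaban 1983–89], NOT PROVED).  Crux-route work under `Spine/NE7b/` by a row leaf (`t4-ne7b-formalise-leaf-06` gen 157) in the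
hard-step cell under FREEZE (0)'s crux-prover clause; NOTHING of Bałaban's is named as a Lean object, valued or asserted; no
`T4Continuum/Support` leaf typed; no `def`; zero `sorry`.  Imports: leaf-03's BUILT `…QuadraticFibreMinimiser` (QFM `le_of_orthogonal_ker`:
the `Q`-orthogonal fibre point has the least energy on its fibre — BY NAME, nothing restated) + Mathlib `bilinearComp`.  Met BY SHAPE
(not imported): leaf-03's `…DominationTransfer` (DT: domination by the PULLBACK of a coarse model form `γ·R(D·)(D·) ≤ Q` descends to
`γ·R ≤ Q⁺` — the companion shape; §4 below links the two), `…TransportedFormCoercivity` (TFC: the crude transport `m₂∕d²`),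
`…HardStepSemigroup` (HSSG: `(Q⁺)⁺` is the once-transported form of the composite), this lineage's `…TransportedHessianEnergyCeiling`
(THEC: the critical section has the least energy; polarisation turns a quadratic ceiling into an operator norm) and
`…ChartLetterTestSection` (CLTS: the chart constant through a test section), leaf-06's HSIS ∕ HSIC (the next Hessian IS
`V″(σw).bilinearComp (σ′w) (σ′w)`, `σ′(w)` a section of `D`, critical along the chart).  PRIOR ART IN THE TREE (VALUE currency,
located by leaf-03 g150 — not restated): `…ConstrainedValueHessian.constrInf_mono` (`0 ≤ q ≤ q′ ⟹ ⨅_{Dδ=w} q ≤ ⨅_{Dδ=w} q′`) and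
`…ConstrainedSchurForm` §5 `softInf_mono` — the constrained infimum is monotone in the functional; and, in MATRIX currency in the β
sub-cell, `Summit.….Beta.GAN24.MonotoneBlocks.effForm_monotone` ∕ `form_shorted_le` (Anderson–Trapp for gan24-p3's finite positive-definite
KKT blocks: `H ≤ H′ ⟹ Δ_eff(H) ≤ Δ_eff(H′)`) — the same classical principle; the OPERATOR ∕ SECTION form below (transported bilinear forms
on a real inner-product space, ANY section for the lower half, explicit `(γ₀, γ₁)` kept along the step and the tower, no invertibility or
finite dimension — HSIS's currency) is this file's statement, proved from QFM, not from those files.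

WHY.  The pricing desk's by-value instruments (PRICING-NE7b v119, F698 ∕ F699) show on the free Gaussian flow in `d = 4` that the
per-step letter boxes die because letters are RE-DERIVED per step with losses (`×1.155` coercivity transport, `×4` chart letter), while
print carries the Gaussian part in CLOSED FORM — the free flow `Δ_k` — and controls the interacting Hessian RELATIVE to it ((1.67):
`Δ_k ≥ γ₀(−Δ)`; the desk: «with `hco₂` RESET per scale the `x_B` letter is ≤ 37.8 uniformly … REGION end alive»).  The abstract
mechanism that makes «relative to the free flow» cost-free along the tower is the monotonicity of the hard step: if `γ₀·P ≤ Q` as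
quadratic forms, then for ANY section `T` of the blocking, `Q[Tk,Tk] ≥ γ₀·P[Tk,Tk] ≥ γ₀·min_{Dδ = k} P[δ,δ] = γ₀·P[Hk,Hk]` where `H` is
`P`'s own critical section (QFM: the `P`-orthogonal fibre point minimises `P`-energy); and if `Q ≤ γ₁·P`, then along `Q`'s critical
section `T`, `Q[Tk,Tk] = min_{Dδ=k} Q ≤ Q[Hk,Hk] ≤ γ₁·P[Hk,Hk]`.  So the sandwich `γ₀·P ≤ Q ≤ γ₁·P` is INHERITED by the hard step with
the same `γ₀, γ₁`, the reference form being replaced by its own hard step `P⁺` — and by HSSG's semigroup law, after `k` steps by the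
reference FLOW `P_k`.  Every by-value letter of the next step is then the reference flow's (a closed-form object the desk's instrument
computes exactly) times a constant that never moves: the kernel-coercivity floor `γ₀·m_P` (§2, the desk's «reset» with no `d²`), the
size ceiling `γ₁·C_P` (§2, THEC's polarisation makes it an operator norm), the chart letter through `H` as test section (CLTS).

WHAT IS PROVED ([folklore]; `E` a real inner-product space (QFM's context), `F`, `G` real normed, `Q P : E →L E →L ℝ`, `D : E →L F`,
sections `T H : F →L E` of `D`; `Q⁺ := Q.bilinearComp T T`, `P⁺ := P.bilinearComp H H`):
* §1 MONOTONICITY: **`transported_ge_of_dominates`** (`P` symmetric and `≥ 0` on `ker D`, `H` the `P`-critical section, `T` ANY section,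
  `0 ≤ γ₀`, `γ₀·P v v ≤ Q v v` on `E` ⟹ `γ₀·P⁺ k k ≤ Q⁺ k k`), **`transported_le_of_dominated`** (`Q` symmetric and `≥ 0` on `ker D`, `T`
  the `Q`-critical section, `H` ANY section, `Q v v ≤ γ₁·P v v` ⟹ `Q⁺ k k ≤ γ₁·P⁺ k k`), **`transported_sandwich`** (both: the same
  `(γ₀, γ₁)` at the next scale).
* §2 THE NEXT STEP's LETTERS FROM THE REFERENCE FLOW's: **`kerCoercive_of_dominates_reference`** (`P⁺` `m_P`-coercive on `ker D₂` ⟹ `Q⁺`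
  `(γ₀·m_P)`-coercive on `ker D₂` — AHE ∕ HSIS's `hco` at the next scale, the desk's RESET, no transport loss), `coercive_of_dominates_reference`
  (on all of `F`), **`quad_le_of_dominated_reference`** (`P⁺ k k ≤ C_P‖k‖²` ⟹ `Q⁺ k k ≤ (γ₁·C_P)‖k‖²` — THEC `opNorm_le_of_abs_quad_le`
  turns it into `‖Q⁺‖ ≤ γ₁·C_P` in an inner-product `F`, by name), `transported_nonneg_of_dominates` (`0 ≤ Q⁺ k k` from `γ₀·P ≤ Q`, `P ≥ 0`).
* §3 THE REFERENCE FLOW STAYS A REFERENCE (so §1 iterates along a tower with HSSG's shapes): `bilinearComp_symm` (`P` symmetric ⟹ `P⁺`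
  symmetric), `bilinearComp_nonneg` (`P ≥ 0` ⟹ `P⁺ ≥ 0`), **`transported_sandwich_twoStep`** (two steps: the sandwich with the SAME
  `(γ₀, γ₁)` for `(Q⁺)⁺` against `(P⁺)⁺`, the second reference section critical for `P⁺`).
* §4 LINK WITH THE PULLBACK SHAPE (DT by shape): `dominates_trans` (`γ₀·P ≤ Q`, `γ₁·R′ ≤ P`, `0 ≤ γ₀` ⟹ `(γ₀γ₁)·R′ ≤ Q` — with
  `R′ v v := R (D v) (D v)` this is DT's hypothesis for `Q` from the REFERENCE form's pullback letter: the model half is asked of `P`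
  once, not of every `Q`).
* §5 toy.

NOT HERE (honest): the reference flow BY VALUE (the free Gaussian flow `Δ_k`, its floors `m_P(k)` and ceilings `C_P(k)` — the desk's
instrument F698 computes them exactly; leaf-01's TSPB ∕ FFTI and the tree's `Literature.….B5Ineq167LowerZd` carry print's scalar
shadows); where the fine-level sandwich `γ₀·P ≤ V″(x) ≤ γ₁·P` on a window comes from (small-field convexity letters — (A3) ∕ (A1c),
NC-NE7b-α UNRULED); the nonlinear remainder of the step (HSIS's moduli); anything of Bałaban's.  BY-NAME EFFECT ON THE WALL: NONE.
NE7b NOT PRINTED ∕ NOT PROVED; spine PROVED 0∕9; rung (B)+1 on a FINITE torus — NOT infinite volume, NOT the mass gap, NOT Clay.  HONEST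
DEPENDENCY: continuum YM on T⁴ ⇐ BetaPertH ∧ nine spine estimates (0∕9 proved); BetaPertH ⇐ (D1) ∧ (D4) ∧ CAP+tail; G-an2-4 gates
asym, D1 and NE2∕3∕4.
-/

set_option autoImplicit false

namespace Summit.QuantumFields.BalabanUV.T4Continuum.NE7b.HardStepMonotone

open Summit.QuantumFields.BalabanUV.T4Continuum.NE7b

section Monotone

variable {E F : Type*} [NormedAddCommGroup E] [InnerProductSpace ℝ E] [NormedAddCommGroup F] [NormedSpace ℝ F]

/-! ## §1. Monotonicity of the hard step -/

/-- **LOWER DOMINATION PASSES THROUGH ANY SECTION.**  `P` symmetric and `≥ 0` on `ker D`, `H` the `P`-critical section of `D`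
(`D(Hk) = k`, `P(Hk)|_{ker D} = 0`), `T` ANY section of `D`, `0 ≤ γ₀` and `γ₀·P v v ≤ Q v v` for all `v` ⟹
`γ₀·(P.bilinearComp H H) k k ≤ (Q.bilinearComp T T) k k`: `Q(Tk)(Tk) ≥ γ₀P(Tk)(Tk) ≥ γ₀P(Hk)(Hk)` — QFM `le_of_orthogonal_ker` for `P` on
the fibre of `k` (`T k` and `H k` lie in it). [folklore] -/
theorem transported_ge_of_dominates (Q P : E →L[ℝ] E →L[ℝ] ℝ) (D : E →L[ℝ] F) (T H : F →L[ℝ] E)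
    (hT : ∀ k, D (T k) = k) (hH : ∀ k, D (H k) = k) (hHorth : ∀ k κ, D κ = 0 → P (H k) κ = 0)
    (hPsymm : ∀ u v, P u v = P v u) (hPpos : ∀ κ, D κ = 0 → 0 ≤ P κ κ)
    {γ₀ : ℝ} (hγ₀ : 0 ≤ γ₀) (hdom : ∀ v, γ₀ * P v v ≤ Q v v) (k : F) :
    γ₀ * (P.bilinearComp H H) k k ≤ (Q.bilinearComp T T) k k := by
  rw [ContinuousLinearMap.bilinearComp_apply, ContinuousLinearMap.bilinearComp_apply]
  have h1 : P (H k) (H k) ≤ P (T k) (T k) :=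
    QuadraticFibreMinimiser.le_of_orthogonal_ker hPsymm hPpos ((hT k).trans (hH k).symm) (hHorth k)
  exact (mul_le_mul_of_nonneg_left h1 hγ₀).trans (hdom (T k))

/-- **UPPER DOMINATION PASSES THROUGH THE CRITICAL SECTION.**  `Q` symmetric and `≥ 0` on `ker D`, `T` the `Q`-critical section
(`Q(Tk)|_{ker D} = 0`), `H` ANY section, `Q v v ≤ γ₁·P v v` for all `v` ⟹ `(Q.bilinearComp T T) k k ≤ γ₁·(P.bilinearComp H H) k k`:
`Q(Tk)(Tk) ≤ Q(Hk)(Hk) ≤ γ₁P(Hk)(Hk)` — QFM for `Q` on the fibre of `k`. [folklore] -/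
theorem transported_le_of_dominated (Q P : E →L[ℝ] E →L[ℝ] ℝ) (D : E →L[ℝ] F) (T H : F →L[ℝ] E)
    (hT : ∀ k, D (T k) = k) (hH : ∀ k, D (H k) = k) (hTorth : ∀ k κ, D κ = 0 → Q (T k) κ = 0)
    (hQsymm : ∀ u v, Q u v = Q v u) (hQpos : ∀ κ, D κ = 0 → 0 ≤ Q κ κ)
    {γ₁ : ℝ} (hdom : ∀ v, Q v v ≤ γ₁ * P v v) (k : F) :
    (Q.bilinearComp T T) k k ≤ γ₁ * (P.bilinearComp H H) k k := by
  rw [ContinuousLinearMap.bilinearComp_apply, ContinuousLinearMap.bilinearComp_apply]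
  have h1 : Q (T k) (T k) ≤ Q (H k) (H k) :=
    QuadraticFibreMinimiser.le_of_orthogonal_ker hQsymm hQpos ((hH k).trans (hT k).symm) (hTorth k)
  exact h1.trans (hdom (H k))

/-- **THE SANDWICH IS INHERITED WITH THE SAME CONSTANTS.**  `Q`, `P` symmetric and `≥ 0` on `ker D`, `T` the `Q`-critical and `H` the
`P`-critical section of `D`, `0 ≤ γ₀`, and `γ₀·P ≤ Q ≤ γ₁·P` as quadratic forms on `E` ⟹ `γ₀·P⁺ ≤ Q⁺ ≤ γ₁·P⁺` pointwise on `F`,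
`Q⁺ = Q.bilinearComp T T`, `P⁺ = P.bilinearComp H H`. [folklore] -/
theorem transported_sandwich (Q P : E →L[ℝ] E →L[ℝ] ℝ) (D : E →L[ℝ] F) (T H : F →L[ℝ] E)
    (hT : ∀ k, D (T k) = k) (hH : ∀ k, D (H k) = k) (hTorth : ∀ k κ, D κ = 0 → Q (T k) κ = 0)
    (hHorth : ∀ k κ, D κ = 0 → P (H k) κ = 0) (hQsymm : ∀ u v, Q u v = Q v u) (hPsymm : ∀ u v, P u v = P v u)
    (hQpos : ∀ κ, D κ = 0 → 0 ≤ Q κ κ) (hPpos : ∀ κ, D κ = 0 → 0 ≤ P κ κ)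
    {γ₀ γ₁ : ℝ} (hγ₀ : 0 ≤ γ₀) (hlo : ∀ v, γ₀ * P v v ≤ Q v v) (hhi : ∀ v, Q v v ≤ γ₁ * P v v) (k : F) :
    γ₀ * (P.bilinearComp H H) k k ≤ (Q.bilinearComp T T) k k ∧
      (Q.bilinearComp T T) k k ≤ γ₁ * (P.bilinearComp H H) k k :=
  ⟨transported_ge_of_dominates Q P D T H hT hH hHorth hPsymm hPpos hγ₀ hlo k,
    transported_le_of_dominated Q P D T H hT hH hTorth hQsymm hQpos hhi k⟩

/-! ## §2. The next step's letters are the reference flow's, times `γ₀` ∕ `γ₁` -/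

variable {G : Type*} [NormedAddCommGroup G] [NormedSpace ℝ G]

/-- **THE NEXT FLOOR FROM THE REFERENCE FLOW's (the RESET, no transport loss).**  Under `transported_ge_of_dominates`' hypotheses, if
the reference form's hard step `P⁺ = P.bilinearComp H H` is `m_P`-coercive on `ker D₂` (`D₂ : F →L G` the next blocking), then
`Q⁺ = Q.bilinearComp T T` is `(γ₀·m_P)`-coercive on `ker D₂` — `…AugmentedHessianEquivalence` ∕ HSIS's `hco` at the next scale VERBATIM. [folklore] -/
theorem kerCoercive_of_dominates_reference (Q P : E →L[ℝ] E →L[ℝ] ℝ) (D : E →L[ℝ] F) (T H : F →L[ℝ] E)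
    (hT : ∀ k, D (T k) = k) (hH : ∀ k, D (H k) = k) (hHorth : ∀ k κ, D κ = 0 → P (H k) κ = 0)
    (hPsymm : ∀ u v, P u v = P v u) (hPpos : ∀ κ, D κ = 0 → 0 ≤ P κ κ)
    {γ₀ : ℝ} (hγ₀ : 0 ≤ γ₀) (hdom : ∀ v, γ₀ * P v v ≤ Q v v)
    (D₂ : F →L[ℝ] G) {mP : ℝ} (hcoP : ∀ k, D₂ k = 0 → mP * ‖k‖ ^ 2 ≤ (P.bilinearComp H H) k k) :
    ∀ k, D₂ k = 0 → γ₀ * mP * ‖k‖ ^ 2 ≤ (Q.bilinearComp T T) k k := fun k hk =>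
  calc γ₀ * mP * ‖k‖ ^ 2 = γ₀ * (mP * ‖k‖ ^ 2) := by ring
    _ ≤ γ₀ * (P.bilinearComp H H) k k := mul_le_mul_of_nonneg_left (hcoP k hk) hγ₀
    _ ≤ (Q.bilinearComp T T) k k := transported_ge_of_dominates Q P D T H hT hH hHorth hPsymm hPpos hγ₀ hdom k

omit [NormedAddCommGroup G] [NormedSpace ℝ G] in
/-- The same on all of `F` (the `D₂ = 0` instance): `P⁺` `m_P`-coercive on `F` ⟹ `Q⁺` `(γ₀·m_P)`-coercive on `F`. [folklore] -/
theorem coercive_of_dominates_reference (Q P : E →L[ℝ] E →L[ℝ] ℝ) (D : E →L[ℝ] F) (T H : F →L[ℝ] E)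
    (hT : ∀ k, D (T k) = k) (hH : ∀ k, D (H k) = k) (hHorth : ∀ k κ, D κ = 0 → P (H k) κ = 0)
    (hPsymm : ∀ u v, P u v = P v u) (hPpos : ∀ κ, D κ = 0 → 0 ≤ P κ κ)
    {γ₀ : ℝ} (hγ₀ : 0 ≤ γ₀) (hdom : ∀ v, γ₀ * P v v ≤ Q v v)
    {mP : ℝ} (hcoP : ∀ k, mP * ‖k‖ ^ 2 ≤ (P.bilinearComp H H) k k) (k : F) :
    γ₀ * mP * ‖k‖ ^ 2 ≤ (Q.bilinearComp T T) k k :=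
  kerCoercive_of_dominates_reference Q P D T H hT hH hHorth hPsymm hPpos hγ₀ hdom (0 : F →L[ℝ] F) (fun k _ => hcoP k) k
    (by simp)

omit [NormedAddCommGroup G] [NormedSpace ℝ G] in
/-- **THE NEXT SIZE CEILING FROM THE REFERENCE FLOW's.**  Under `transported_le_of_dominated`'s hypotheses, a quadratic ceiling of the
reference form's hard step, `P⁺ k k ≤ C_P‖k‖²`, and `0 ≤ γ₁` give `Q⁺ k k ≤ (γ₁·C_P)‖k‖²` (THEC `opNorm_le_of_abs_quad_le` then bounds
`‖Q⁺‖` by `γ₁·C_P` in an inner-product `F` when `Q⁺ ≥ 0` — by name, not imported). [folklore] -/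
theorem quad_le_of_dominated_reference (Q P : E →L[ℝ] E →L[ℝ] ℝ) (D : E →L[ℝ] F) (T H : F →L[ℝ] E)
    (hT : ∀ k, D (T k) = k) (hH : ∀ k, D (H k) = k) (hTorth : ∀ k κ, D κ = 0 → Q (T k) κ = 0)
    (hQsymm : ∀ u v, Q u v = Q v u) (hQpos : ∀ κ, D κ = 0 → 0 ≤ Q κ κ)
    {γ₁ : ℝ} (hγ₁ : 0 ≤ γ₁) (hdom : ∀ v, Q v v ≤ γ₁ * P v v)
    {CP : ℝ} (hCP : ∀ k, (P.bilinearComp H H) k k ≤ CP * ‖k‖ ^ 2) (k : F) :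
    (Q.bilinearComp T T) k k ≤ γ₁ * CP * ‖k‖ ^ 2 :=
  calc (Q.bilinearComp T T) k k ≤ γ₁ * (P.bilinearComp H H) k k :=
        transported_le_of_dominated Q P D T H hT hH hTorth hQsymm hQpos hdom k
    _ ≤ γ₁ * (CP * ‖k‖ ^ 2) := mul_le_mul_of_nonneg_left (hCP k) hγ₁
    _ = γ₁ * CP * ‖k‖ ^ 2 := by ring

omit [InnerProductSpace ℝ E] [NormedAddCommGroup G] [NormedSpace ℝ G] in
/-- POSITIVITY IS INHERITED: `0 ≤ γ₀`, `γ₀·P ≤ Q` and `P ≥ 0` on `E` ⟹ `0 ≤ Q⁺ k k` for any `T`. [folklore] -/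
theorem transported_nonneg_of_dominates [NormedSpace ℝ E] (Q P : E →L[ℝ] E →L[ℝ] ℝ) (T : F →L[ℝ] E) {γ₀ : ℝ} (hγ₀ : 0 ≤ γ₀)
    (hdom : ∀ v, γ₀ * P v v ≤ Q v v) (hP0 : ∀ v, 0 ≤ P v v) (k : F) : 0 ≤ (Q.bilinearComp T T) k k := by
  rw [ContinuousLinearMap.bilinearComp_apply]
  exact (mul_nonneg hγ₀ (hP0 (T k))).trans (hdom (T k))

/-! ## §3. The reference flow stays a reference; two steps -/

omit [InnerProductSpace ℝ E] [NormedAddCommGroup G] [NormedSpace ℝ G] in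
/-- A transported symmetric form is symmetric. [folklore] -/
theorem bilinearComp_symm [NormedSpace ℝ E] (P : E →L[ℝ] E →L[ℝ] ℝ) (H : F →L[ℝ] E) (hPsymm : ∀ u v, P u v = P v u) (a b : F) :
    (P.bilinearComp H H) a b = (P.bilinearComp H H) b a := by
  rw [ContinuousLinearMap.bilinearComp_apply, ContinuousLinearMap.bilinearComp_apply, hPsymm]

omit [InnerProductSpace ℝ E] [NormedAddCommGroup G] [NormedSpace ℝ G] in
/-- A transported nonnegative form is nonnegative. [folklore] -/
theorem bilinearComp_nonneg [NormedSpace ℝ E] (P : E →L[ℝ] E →L[ℝ] ℝ) (H : F →L[ℝ] E) (hP0 : ∀ v, 0 ≤ P v v) (a : F) :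
    0 ≤ (P.bilinearComp H H) a a := by
  rw [ContinuousLinearMap.bilinearComp_apply]; exact hP0 _

/-- **TWO STEPS, THE SAME CONSTANTS** (the shape that iterates along a tower; with HSSG's `bilinearComp_bilinearComp` the twice-transported
forms are the once-transported forms of the composite blocking).  `F` an inner-product space (QFM at the second scale).  Step 1 as in
`transported_sandwich`; step 2: `D₂ : F →L G`, `T₂` the `Q⁺`-critical and `H₂` the `P⁺`-critical section of `D₂`; `Q ≥ 0`, `P ≥ 0` on
all of `E` (so that `Q⁺`, `P⁺` are `≥ 0` on `ker D₂`) ⟹ `γ₀·(P⁺)⁺ ≤ (Q⁺)⁺ ≤ γ₁·(P⁺)⁺` with the SAME `γ₀, γ₁`. [folklore] -/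
theorem transported_sandwich_twoStep {F₁ : Type*} [NormedAddCommGroup F₁] [InnerProductSpace ℝ F₁]
    (Q P : E →L[ℝ] E →L[ℝ] ℝ) (D : E →L[ℝ] F₁) (T H : F₁ →L[ℝ] E)
    (hT : ∀ k, D (T k) = k) (hH : ∀ k, D (H k) = k) (hTorth : ∀ k κ, D κ = 0 → Q (T k) κ = 0)
    (hHorth : ∀ k κ, D κ = 0 → P (H k) κ = 0) (hQsymm : ∀ u v, Q u v = Q v u) (hPsymm : ∀ u v, P u v = P v u)
    (hQ0 : ∀ v, 0 ≤ Q v v) (hP0 : ∀ v, 0 ≤ P v v)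
    {γ₀ γ₁ : ℝ} (hγ₀ : 0 ≤ γ₀) (hlo : ∀ v, γ₀ * P v v ≤ Q v v) (hhi : ∀ v, Q v v ≤ γ₁ * P v v)
    (D₂ : F₁ →L[ℝ] G) (T₂ H₂ : G →L[ℝ] F₁) (hT₂ : ∀ g, D₂ (T₂ g) = g) (hH₂ : ∀ g, D₂ (H₂ g) = g)
    (hT₂orth : ∀ g κ, D₂ κ = 0 → (Q.bilinearComp T T) (T₂ g) κ = 0)
    (hH₂orth : ∀ g κ, D₂ κ = 0 → (P.bilinearComp H H) (H₂ g) κ = 0) (g : G) :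
    γ₀ * ((P.bilinearComp H H).bilinearComp H₂ H₂) g g ≤ ((Q.bilinearComp T T).bilinearComp T₂ T₂) g g ∧
      ((Q.bilinearComp T T).bilinearComp T₂ T₂) g g ≤ γ₁ * ((P.bilinearComp H H).bilinearComp H₂ H₂) g g :=
  transported_sandwich (Q.bilinearComp T T) (P.bilinearComp H H) D₂ T₂ H₂ hT₂ hH₂ hT₂orth hH₂orth
    (bilinearComp_symm Q T hQsymm) (bilinearComp_symm P H hPsymm)
    (fun κ _ => bilinearComp_nonneg Q T hQ0 κ) (fun κ _ => bilinearComp_nonneg P H hP0 κ) hγ₀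
    (fun v => transported_ge_of_dominates Q P D T H hT hH hHorth hPsymm (fun κ _ => hP0 κ) hγ₀ hlo v)
    (fun v => transported_le_of_dominated Q P D T H hT hH hTorth hQsymm (fun κ _ => hQ0 κ) hhi v) g

/-! ## §4. Link with the pullback shape (`…DominationTransfer` by shape) -/

omit [InnerProductSpace ℝ E] [NormedAddCommGroup G] [NormedSpace ℝ G] [NormedAddCommGroup F] [NormedSpace ℝ F] in
/-- **DOMINATIONS COMPOSE**: `γ₀·P ≤ Q` and `γ₁·R′ ≤ P` (`0 ≤ γ₀`) ⟹ `(γ₀γ₁)·R′ ≤ Q`.  With `R′ v := R (D v) (D v)` the second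
hypothesis is the REFERENCE form's pullback letter (the model half, asked of `P` once) and the conclusion is `…DominationTransfer`'s
hypothesis for `Q` with the constant `γ₀γ₁`. [folklore] -/
theorem dominates_trans [NormedSpace ℝ E] {Q P : E →L[ℝ] E →L[ℝ] ℝ} {R' : E → ℝ} {γ₀ γ₁ : ℝ} (hγ₀ : 0 ≤ γ₀)
    (hPQ : ∀ v, γ₀ * P v v ≤ Q v v) (hRP : ∀ v, γ₁ * R' v ≤ P v v) (v : E) : γ₀ * γ₁ * R' v ≤ Q v v :=
  calc γ₀ * γ₁ * R' v = γ₀ * (γ₁ * R' v) := by ring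
    _ ≤ γ₀ * P v v := mul_le_mul_of_nonneg_left (hRP v) hγ₀
    _ ≤ Q v v := hPQ v

end Monotone

/-! ## §5. Toy -/

/-- Toy (`E = F = ℝ`, `D = T = H = id`, `Q = 3·mul`, `P = mul`, `γ₀ = 2`): `ker D = 0`, every kernel letter is vacuous, and §1 reads
`2·(k·k) ≤ 3·(k·k)`. -/
example (k : ℝ) :
    2 * ((ContinuousLinearMap.mul ℝ ℝ).bilinearComp (ContinuousLinearMap.id ℝ ℝ) (ContinuousLinearMap.id ℝ ℝ)) k k ≤
      (((3 : ℝ) • ContinuousLinearMap.mul ℝ ℝ).bilinearComp (ContinuousLinearMap.id ℝ ℝ) (ContinuousLinearMap.id ℝ ℝ)) k k :=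
  HardStepMonotone.transported_ge_of_dominates ((3 : ℝ) • ContinuousLinearMap.mul ℝ ℝ) (ContinuousLinearMap.mul ℝ ℝ)
    (ContinuousLinearMap.id ℝ ℝ) (ContinuousLinearMap.id ℝ ℝ) (ContinuousLinearMap.id ℝ ℝ) (fun _ => rfl) (fun _ => rfl)
    (fun k κ hκ => by simp [show κ = 0 from hκ]) (fun u v => by simp [mul_comm]) (fun κ _ => by simpa using mul_self_nonneg κ)
    (by norm_num) (fun v => by simp; nlinarith [mul_self_nonneg v]) k

end Summit.QuantumFields.BalabanUV.T4Continuum.NE7b.HardStepMonotone
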